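import Literature.Geometry.Lorentzian.CausalityPushUp
import Literature.Geometry.Lorentzian.IdealPoints
import Summits.FinalStateConjecture.FinalStateConjecture.Theorems.BartnikGapSettlingGapExhaustionSegmentTimelike
import Summits.FinalStateConjecture.FinalStateConjecture.Theorems.BartnikGapSettlingGapExhaustionChartSegmentChronological
import Summits.FinalStateConjecture.FinalStateConjecture.Theorems.BartnikGapSettlingGapExhaustionFutureDirectedDichotomy
import Literature.Geometry.Lorentzian.KerrRadiusGradientVector
import HarnessLib

/-!
# Crux `GapExhaustion` (stmt-FinalStateConjecture-10808), line `photon-shell-pseudoconvexity`: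
# stubs (E-5a) `stub_escapeChain` and (E-5b) `stub_escapeSegment` — the two halves of the ESCAPE
# argument (§1f of the line; lead c9): a chain of short straight chart segments along an escape
# field climbs from the band to the far zone; each segment is uniformly controlled

Route `BartnikGapSettling`; helper (`--supports stmt-FinalStateConjecture-10808`). The node of the
line (`EternalSilentNearKerrIsKerr`) phrases its causal sets through
`docOf = I⁻(far zone)` and `belowZone ρ = Ψ({r < ρ}) ∩ docOf`; the sweeps S5/S6b need these to be
honest chart sublevel regions of the Kerr–Schild radius. The localisation itself
(`stub_docLocalisation`, file `…DocLocalisation.lean`) says: for a chart `Φ` on `{r > M}` whose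
pulled-back components are `δ`-close in `C¹` to the Kerr–Schild form `g_{M,a}` on the band
`r₊ + η/2 ≤ r ≤ R + 2`, EVERY point with `r₊ + η ≤ r ≤ R` lies in `I⁻(Φ({r > R}))` — with NO
hypothesis relating the ambient time orientation to the chart. This file proves its two halves.
Mechanism: the two exact-Kerr escape fields `Y₁, Y₂` of (E-1b) (timelike with margin, in opposite
time-cones, `dr(Yᵢ) ≥ ν > 0`, bounded, continuous beyond `r₊`) stay timelike for the perturbed
components; short straight chart segments `s ↦ z + s Yᵢ(z)` of a uniform length `s₀` stay
timelike and gain radius `≥ s₀ν/2` ((E-2) with the uniform tube constants of (E-6)); each segment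
is a chronological relation of the spacetime ((E-3)), the orientation class of `Yᵢ` propagates
along the chain ((E-4) on the segment, by continuity of `Yᵢ`), and finitely many segments reach
`{r > R}`; at the starting point one of `dΦ Y₁, dΦ Y₂` is future-directed (they pair positively),
and that one is followed. O'Neill 1983, Ch. 14 (chronological relations, time duality);
Dafermos–Rodnianski arXiv:0811.0354 §5.1 (`−g♯dt*` timelike).
-/

noncomputable section

set_option maxSynthPendingDepth 3

-- D-0017: single-problem summit, `Summit.<S>.<S>.…` by design (cf. lakefile `weak.linter.dupNamespace`).
set_option linter.dupNamespace false

namespace Summit.FinalStateConjecture.FinalStateConjecture.Theorems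

open Set Metric Function
open Literature.Geometry.Lorentzian
open scoped Manifold ContDiff Topology

/-- **The escape chain.** Let `Φ` be smooth with injective differential on the open `O ⊆ E4`,
`f : E4 → ℝ`, `Y : E4 → E4`, `s₀, c > 0`, and suppose that from every point `z` with
`lo ≤ f z ≤ R` the straight segment `s ↦ z + s • Y z`, `s ∈ [0, s₀]`, stays in `O`, is timelike
for the pulled-back components with its constant tangent `Y z` AND with the (continuous) field
`Y` itself, and gains `f (z + s₀ • Y z) ≥ f z + s₀ c`. Then from every such `z` at which `dΦ (Y z)`
is future-directed, `Φ z ∈ I⁻(Φ({f > R}))`: induction on the number of segments needed, the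
orientation class being carried along each segment by the dichotomy (E-4), each segment being a
chronological relation by (E-3), and `≪` being transitive. O'Neill 1983, Ch. 14, pp. 402–403. -/
theorem stub_escapeChain :
    ∀ (𝓢 : Spacetime.{0} 4), ∀ (Φ : E4 → 𝓢.carrier), ∀ (O : Set E4), ∀ (f : E4 → ℝ), ∀ (Y : E4 →
      E4), ∀ (lo R s₀ c : ℝ), (IsOpen O) → (ContMDiffOn 𝓘(ℝ, E4) (𝓡 4) ∞ Φ O) → (∀ y ∈ O,
      Function.Injective (mfderiv 𝓘(ℝ, E4) (𝓡 4) Φ y)) → (0 < s₀) → (0 < c) → (∀ z, lo ≤ f z → f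
      z ≤ R → ∀ s ∈ Icc (0 : ℝ) s₀, z + s • Y z ∈ O) → (∀ z, lo ≤ f z → f z ≤ R → ∀ s ∈ Icc (0 :
      ℝ) s₀, 𝓢.metricInCoords Φ (z + s • Y z) (Y z) (Y z) < 0) → (∀ z, lo ≤ f z → f z ≤ R →
      ContinuousOn Y ((fun s : ℝ ↦ z + s • Y z) '' Icc 0 s₀)) → (∀ z, lo ≤ f z → f z ≤ R → ∀ s ∈
      Icc (0 : ℝ) s₀, 𝓢.metricInCoords Φ (z + s • Y z) (Y (z + s • Y z)) (Y (z + s • Y z)) < 0) →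
      (∀ z, lo ≤ f z → f z ≤ R → f z + s₀ * c ≤ f (z + s₀ • Y z)) → ∀ (n : ℕ) (z : E4), lo ≤ f z
      → f z ≤ R → R < f z + n * (s₀ * c) → 𝓢.timeOrientation.IsFutureDirected (mfderiv 𝓘(ℝ, E4)
      (𝓡 4) Φ z (Y z)) → Φ z ∈ 𝓢.metric.chronologicalPast 𝓢.timeOrientation (Φ '' {y | R < f y}) := by
  intro 𝓢 Φ O f Y lo R s₀ c hO hΦ hinj hs₀ hc hmem htl hcont htlY hgain n
  induction n with
  | zero =>
    intro z _ hzR hn _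
    simp only [Nat.cast_zero, zero_mul, add_zero] at hn
    exact absurd hn (not_lt.2 hzR)
  | succ n ih =>
    intro z hlo hzR hn hfut
    set v : E4 := Y z with hv
    set z' : E4 := z + s₀ • v with hz'
    -- the segment and its points
    have hseg_mem : ∀ s ∈ Icc (0 : ℝ) s₀, z + s • v ∈ O := hmem z hlo hzR
    -- (E-4) with the CONSTANT field `v` on the segment: future at `s = 0`, hence everywhere
    set A : Set E4 := (fun s : ℝ ↦ z + s • v) '' Icc 0 s₀ with hA
    have hAO : A ⊆ O := by
      rintro _ ⟨s, hs, rfl⟩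
      exact hseg_mem s hs
    have hApc : IsPreconnected A :=
      (isPreconnected_Icc).image _ ((continuous_const.add (continuous_id.smul continuous_const)).continuousOn)
    have hz_mem : z ∈ A := ⟨0, ⟨le_rfl, hs₀.le⟩, by simp⟩
    have hz'_mem : z' ∈ A := ⟨s₀, ⟨hs₀.le, le_rfl⟩, rfl⟩
    have hconst := stub_futureDirected_dichotomy 𝓢 Φ O A (fun _ ↦ v) hO hΦ hinj hAO hApc
      continuousOn_const (by
        rintro _ ⟨s, hs, rfl⟩
        exact htl z hlo hzR s hs)
    have hfut_all : ∀ x ∈ A, 𝓢.timeOrientation.IsFutureDirected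
        (mfderiv 𝓘(ℝ, E4) (𝓡 4) Φ x v) := by
      rcases hconst with h | h
      · exact h
      · exfalso
        have hpast : 𝓢.timeOrientation.IsPastDirected (mfderiv 𝓘(ℝ, E4) (𝓡 4) Φ z v) := by
          have h0 := h z hz_mem
          have hmn : mfderiv 𝓘(ℝ, E4) (𝓡 4) Φ z (-v) = -(mfderiv 𝓘(ℝ, E4) (𝓡 4) Φ z v) :=
            (mfderiv 𝓘(ℝ, E4) (𝓡 4) Φ z).map_neg v
          rw [hmn, TimeOrientation.isFutureDirected_neg_iff] at h0
          exact h0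
        exact (𝓢.timeOrientation.not_isPastDirected_of_isFutureDirected hfut) hpast
    -- (E-3): the segment is a chronological relation
    have hchron : Φ z' ∈ 𝓢.metric.chronologicalFuture 𝓢.timeOrientation {Φ z} :=
      stub_chartSegment_chronological 𝓢 Φ O z v s₀ hO hΦ hs₀ hseg_mem (htl z hlo hzR)
        (fun s hs ↦ hfut_all _ ⟨s, hs, rfl⟩)
    have hpast_z : Φ z ∈ 𝓢.metric.chronologicalPast 𝓢.timeOrientation {Φ z'} :=
      LorentzianMetric.mem_chronologicalPast_of_mem_chronologicalFuture hchron
    -- radius gain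
    have hgain' : f z + s₀ * c ≤ f z' := hgain z hlo hzR
    rcases lt_or_ge R (f z') with hfar | hnear
    · -- the endpoint is already in the far zone
      have hz'far : Φ z' ∈ Φ '' {y | R < f y} := mem_image_of_mem Φ hfar
      exact LorentzianMetric.chronologicalPast_mono (singleton_subset_iff.2 hz'far) hpast_z
    · -- otherwise continue from `z'`: the orientation class of `Y` is carried along the segment
      have hcontY := stub_futureDirected_dichotomy 𝓢 Φ O A Y hO hΦ hinj hAO hApc
        (hcont z hlo hzR) (by
          rintro _ ⟨s, hs, rfl⟩
          exact htlY z hlo hzR s hs)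
      have hfut' : 𝓢.timeOrientation.IsFutureDirected (mfderiv 𝓘(ℝ, E4) (𝓡 4) Φ z' (Y z')) := by
        rcases hcontY with h | h
        · exact h z' hz'_mem
        · exfalso
          have h0 := h z hz_mem
          have hmn : mfderiv 𝓘(ℝ, E4) (𝓡 4) Φ z (-Y z) = -(mfderiv 𝓘(ℝ, E4) (𝓡 4) Φ z (Y z)) :=
            (mfderiv 𝓘(ℝ, E4) (𝓡 4) Φ z).map_neg (Y z)
          rw [hmn, TimeOrientation.isFutureDirected_neg_iff] at h0
          exact (𝓢.timeOrientation.not_isPastDirected_of_isFutureDirected hfut) h0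
      have hlo' : lo ≤ f z' := by
        have : 0 ≤ s₀ * c := by positivity
        linarith
      have hn' : R < f z' + n * (s₀ * c) := by
        push_cast at hn
        linarith
      have ih' := ih z' hlo' hnear hn' hfut'
      exact LorentzianMetric.mem_chronologicalPast_trans ih' hpast_z

/-- **One escape segment, uniformly.** In the setting of `stub_docLocalisation` (tube constants
of (E-6) around the band `r₊ + η ≤ r ≤ R + 1`, `C¹`-closeness `δ` on `r₊ + η/2 ≤ r ≤ R + 2`, an
escape field `Y` of (E-1b): bounded by `L`, Kerr-timelike with margin `m`, `dr(Y) ≥ ν`, on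
`r₊ + η ≤ r ≤ R + 2`), with `δ L² ≤ m/2` and a segment length `s₀` so small that `s₀ L ≤ ρ₀`,
`L₃ s₀ L ≤ η/2`, `L₃ s₀ L ≤ 1`, `s₀ (L₁ + 1) L³ ≤ m/4`, `s₀ L₂ L² ≤ ν/2`: from every `z` with
`r₊ + η ≤ r z ≤ R` the segment `z + s • Y z`, `0 ≤ s ≤ s₀`, stays in `{r > M}`, is timelike for
the pulled-back components with its constant tangent and with the field `Y`, and gains radius
`≥ s₀ ν/2` ((E-2) on the ball `closedBall z (s₀ L)` with the mean-value Lipschitz constants). -/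
theorem stub_escapeSegment :
    ∀ (𝓢 : Spacetime.{0} 4), ∀ (Φ : E4 → 𝓢.carrier), ∀ (M a η R δ m ν L ρ₀ L₁ L₂ L₃ B₀ s₀ : ℝ), ∀
      (Y : E4 → E4), (0 < η) → (0 < m) → (0 < ν) → (0 < L) → (0 ≤ L₁) → (0 ≤ L₂) → (0 ≤ L₃) → (0
      < δ) → (δ ≤ 1) → (δ * L ^ 2 ≤ m / 2) → (0 < s₀) → (s₀ * L ≤ ρ₀) → (L₃ * (s₀ * L) ≤ η / 2) →
      (L₃ * (s₀ * L) ≤ 1) → (s₀ * ((L₁ + 1) * L ^ 3) ≤ m / 2 / 2) → (s₀ * (L₂ * L ^ 2) ≤ ν / 2) →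
      (ContMDiffOn 𝓘(ℝ, E4) (𝓡 4) ∞ Φ {x | M < Kerr.radius a x}) → (∀ z : E4, Kerr.rPlus M a + η
      ≤ Kerr.radius a z → Kerr.radius a z ≤ R + 1 → ∀ w : E4, ‖w‖ ≤ ρ₀ → (Kerr.rPlus M a + η) / 2
      < Kerr.radius a (z + w) ∧ |Kerr.radius a (z + w) - Kerr.radius a z| ≤ L₃ * ‖w‖ ∧ ContDiffAt
      ℝ 2 (Kerr.bilin M a) (z + w) ∧ ContDiffAt ℝ 2 (Kerr.radius a) (z + w) ∧ ‖Kerr.bilin M a (z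
      + w)‖ ≤ B₀ ∧ ‖fderiv ℝ (Kerr.bilin M a) (z + w)‖ ≤ L₁ ∧ ‖fderiv ℝ (Kerr.radius a) (z + w)‖
      ≤ L₃ ∧ ‖fderiv ℝ (fderiv ℝ (Kerr.radius a)) (z + w)‖ ≤ L₂) → (∀ x : E4, Kerr.rPlus M a + η
      / 2 ≤ Kerr.radius a x → Kerr.radius a x ≤ R + 2 → ‖𝓢.metricInCoords Φ x - Kerr.bilin M a x‖
      ≤ δ ∧ ‖fderiv ℝ (𝓢.metricInCoords Φ) x - fderiv ℝ (Kerr.bilin M a) x‖ ≤ δ) → (∀ x : E4,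
      Kerr.rPlus M a + η ≤ Kerr.radius a x → Kerr.radius a x ≤ R + 2 → ‖Y x‖ ≤ L ∧ Kerr.bilin M a
      x (Y x) (Y x) ≤ -m ∧ ν ≤ fderiv ℝ (Kerr.radius a) x (Y x)) → (ContinuousOn Y {x |
      Kerr.rPlus M a < Kerr.radius a x}) → ∀ (z : E4), (Kerr.rPlus M a + η ≤ Kerr.radius a z) →
      (Kerr.radius a z ≤ R) → (∀ s ∈ Icc (0 : ℝ) s₀, M < Kerr.radius a (z + s • Y z)) ∧ (∀ s ∈
      Icc (0 : ℝ) s₀, 𝓢.metricInCoords Φ (z + s • Y z) (Y z) (Y z) < 0) ∧ ContinuousOn Y ((fun s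
      : ℝ ↦ z + s • Y z) '' Icc 0 s₀) ∧ (∀ s ∈ Icc (0 : ℝ) s₀, 𝓢.metricInCoords Φ (z + s • Y z)
      (Y (z + s • Y z)) (Y (z + s • Y z)) < 0) ∧ Kerr.radius a z + s₀ * (ν / 2) ≤ Kerr.radius a
      (z + s₀ • Y z) := by
  intro 𝓢 Φ M a η R δ m ν L ρ₀ L₁ L₂ L₃ B₀ s₀ Y hη hm hν hL hL₁ hL₂ hL₃ hδ hδ1 hδm hs₀ hs₀ρ hs₀η hs₀1 hs₀m hs₀ν hΦ hreg hclose hY hYc z hzlo hzR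
  -- notation
  set rp : ℝ := Kerr.rPlus M a with hrp
  set f : E4 → ℝ := Kerr.radius a with hf
  set K : E4 → E4 →L[ℝ] E4 →L[ℝ] ℝ := Kerr.bilin M a with hK
  set G : E4 → E4 →L[ℝ] E4 →L[ℝ] ℝ := 𝓢.metricInCoords Φ with hG
  have hrpM : M ≤ rp := le_add_of_nonneg_right (Real.sqrt_nonneg _)
  have hzR1 : f z ≤ R + 1 := by show Kerr.radius a z ≤ R + 1; linarith
  obtain ⟨hvL, hKvv, hνv⟩ := hY z hzlo (by show Kerr.radius a z ≤ R + 2; linarith)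
  set v : E4 := Y z with hv
  -- points of the tube around `z` at distance `≤ s₀ L`
  have htube : ∀ w : E4, ‖w‖ ≤ s₀ * L →
      rp + η / 2 ≤ f (z + w) ∧ f (z + w) ≤ R + 2 ∧ M < f (z + w) ∧
      ContDiffAt ℝ 2 K (z + w) ∧ ContDiffAt ℝ 2 f (z + w) ∧
      ‖fderiv ℝ K (z + w)‖ ≤ L₁ ∧ ‖fderiv ℝ (fderiv ℝ f) (z + w)‖ ≤ L₂ := by
    intro w hw
    obtain ⟨-, hlip, hK2, hf2, -, hK1, -, hf2'⟩ := hreg z hzlo hzR1 w (hw.trans hs₀ρ)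
    have h1 : |f (z + w) - f z| ≤ η / 2 :=
      hlip.trans ((mul_le_mul_of_nonneg_left hw hL₃).trans hs₀η)
    have h2 : |f (z + w) - f z| ≤ 1 :=
      hlip.trans ((mul_le_mul_of_nonneg_left hw hL₃).trans hs₀1)
    have h3 : rp + η / 2 ≤ f (z + w) := by
      have := (abs_le.1 h1).1
      show Kerr.rPlus M a + η / 2 ≤ Kerr.radius a (z + w)
      linarith [show Kerr.rPlus M a + η ≤ Kerr.radius a z from hzlo]
    refine ⟨h3, ?_, ?_, hK2, hf2, hK1, hf2'⟩
    · have := (abs_le.1 h2).2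
      show Kerr.radius a (z + w) ≤ R + 2
      linarith [show Kerr.radius a z ≤ R from hzR]
    · show M < Kerr.radius a (z + w)
      have h3' : Kerr.rPlus M a + η / 2 ≤ Kerr.radius a (z + w) := h3
      linarith
  -- segment points are tube points
  have hsegw : ∀ s ∈ Icc (0 : ℝ) s₀, ‖s • v‖ ≤ s₀ * L := by
    intro s hs
    rw [norm_smul, Real.norm_eq_abs, abs_of_nonneg hs.1]
    exact mul_le_mul hs.2 hvL (norm_nonneg _) hs₀.le
  have hO : IsOpen {x : E4 | M < Kerr.radius a x} :=
    isOpen_lt continuous_const (Kerr.continuous_radius a)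
  have hGsmooth : ContDiffOn ℝ ∞ G {x : E4 | M < Kerr.radius a x} :=
    𝓢.contDiffOn_metricInCoords hO hΦ
  -- (E-2) on the closed ball `closedBall z (s₀ L)`
  set C : Set E4 := closedBall z (s₀ * L) with hC
  have hCmem : ∀ x ∈ C, ∃ w : E4, ‖w‖ ≤ s₀ * L ∧ x = z + w := fun x hx ↦
    ⟨x - z, by rwa [mem_closedBall, dist_eq_norm] at hx, by abel⟩
  have hGdiff : ∀ x ∈ C, DifferentiableAt ℝ G x := by
    intro x hx
    obtain ⟨w, hw, rfl⟩ := hCmem x hx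
    have hxO : z + w ∈ {x : E4 | M < Kerr.radius a x} := (htube w hw).2.2.1
    exact ((hGsmooth _ hxO).contDiffAt (hO.mem_nhds hxO)).differentiableAt (by simp)
  have hGbound : ∀ x ∈ C, ‖fderiv ℝ G x‖ ≤ L₁ + 1 := by
    intro x hx
    obtain ⟨w, hw, rfl⟩ := hCmem x hx
    obtain ⟨h1, h2, -, -, -, hK1, -⟩ := htube w hw
    have hcl := (hclose (z + w) h1 h2).2
    calc ‖fderiv ℝ G (z + w)‖
        = ‖fderiv ℝ K (z + w) + (fderiv ℝ G (z + w) - fderiv ℝ K (z + w))‖ := by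
          congr 1; abel
      _ ≤ ‖fderiv ℝ K (z + w)‖ + ‖fderiv ℝ G (z + w) - fderiv ℝ K (z + w)‖ := norm_add_le _ _
      _ ≤ L₁ + 1 := add_le_add hK1 (hcl.trans hδ1)
  have hGlip : ∀ x ∈ C, ∀ y ∈ C, ‖G x - G y‖ ≤ (L₁ + 1) * ‖x - y‖ := fun x hx y hy ↦
    (convex_closedBall z (s₀ * L)).norm_image_sub_le_of_norm_fderiv_le hGdiff hGbound hy hx
  have hfdiff : ∀ x ∈ C, DifferentiableAt ℝ f x := by
    intro x hx
    obtain ⟨w, hw, rfl⟩ := hCmem x hx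
    exact (htube w hw).2.2.2.2.1.differentiableAt (by norm_num)
  have hfdiff' : ∀ x ∈ C, DifferentiableAt ℝ (fderiv ℝ f) x := by
    intro x hx
    obtain ⟨w, hw, rfl⟩ := hCmem x hx
    exact ((htube w hw).2.2.2.2.1.fderiv_right (m := 1) (by norm_num)).differentiableAt one_ne_zero
  have hfbound : ∀ x ∈ C, ‖fderiv ℝ (fderiv ℝ f) x‖ ≤ L₂ := by
    intro x hx
    obtain ⟨w, hw, rfl⟩ := hCmem x hx
    exact (htube w hw).2.2.2.2.2.2
  have hflip : ∀ x ∈ C, ∀ y ∈ C, ‖fderiv ℝ f x - fderiv ℝ f y‖ ≤ L₂ * ‖x - y‖ := fun x hx y hy ↦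
    (convex_closedBall z (s₀ * L)).norm_image_sub_le_of_norm_fderiv_le hfdiff' hfbound hy hx
  -- the margin at `z` for the perturbed components
  have hGzvv : G z v v ≤ -(m / 2) := by
    have hcl := (hclose z (by show Kerr.rPlus M a + η / 2 ≤ Kerr.radius a z; linarith)
      (by show Kerr.radius a z ≤ R + 2; linarith)).1
    have hdiff : |G z v v - K z v v| ≤ δ * L ^ 2 := by
      have h1 : |(G z - K z) v v| ≤ ‖G z - K z‖ * ‖v‖ * ‖v‖ :=
        (Real.norm_eq_abs _ ▸ (G z - K z).le_opNorm₂ v v)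
      simp only [FunLike.coe_sub, Pi.sub_apply] at h1
      refine h1.trans ?_
      have : ‖G z - K z‖ * ‖v‖ * ‖v‖ ≤ δ * L * L :=
        mul_le_mul (mul_le_mul hcl hvL (norm_nonneg _) hδ.le) hvL (norm_nonneg _)
          (by positivity)
      nlinarith
    have := (abs_le.1 hdiff).2
    linarith
  -- (E-2) for every parameter `s ∈ [0, s₀]`
  have hE2 : ∀ s ∈ Icc (0 : ℝ) s₀,
      G (z + s • v) v v ≤ -(m / 2 / 2) ∧ f z + s * (ν / 2) ≤ f (z + s • v) := by
    intro s hs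
    refine stub_segmentTimelike G f C (L₁ + 1) L₂ L (m / 2) ν (convex_closedBall z (s₀ * L))
      (by positivity) hL₂ hL (by positivity) hν hGlip hfdiff hflip z v s hvL hGzvv hνv hs.1
      ?_ ?_ ?_
    · exact (mul_le_mul_of_nonneg_right hs.2 (by positivity)).trans hs₀m
    · exact (mul_le_mul_of_nonneg_right hs.2 (by positivity)).trans hs₀ν
    · intro s' hs'
      show z + s' • v ∈ closedBall z (s₀ * L)
      rw [mem_closedBall, dist_eq_norm, add_sub_cancel_left]
      exact hsegw s' ⟨hs'.1, hs'.2.trans hs.2⟩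
  -- consequences along the segment
  have hsegband : ∀ s ∈ Icc (0 : ℝ) s₀,
      rp + η ≤ f (z + s • v) ∧ f (z + s • v) ≤ R + 2 ∧ M < f (z + s • v) := by
    intro s hs
    obtain ⟨-, h2, h3, -⟩ := htube (s • v) (hsegw s hs)
    refine ⟨?_, h2, h3⟩
    have hgain := (hE2 s hs).2
    have : 0 ≤ s * (ν / 2) := by have := hs.1; positivity
    show Kerr.rPlus M a + η ≤ Kerr.radius a (z + s • v)
    have hgain' : Kerr.radius a z + s * (ν / 2) ≤ Kerr.radius a (z + s • v) := hgain
    linarith [show Kerr.rPlus M a + η ≤ Kerr.radius a z from hzlo]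
  refine ⟨fun s hs ↦ (hsegband s hs).2.2, fun s hs ↦ ?_, ?_, fun s hs ↦ ?_, (hE2 s₀ ⟨hs₀.le, le_rfl⟩).2⟩
  · have := (hE2 s hs).1
    have hm8 : 0 < m / 2 / 2 := by positivity
    show G (z + s • v) v v < 0
    linarith
  · refine hYc.mono ?_
    rintro _ ⟨s, hs, rfl⟩
    show Kerr.rPlus M a < Kerr.radius a (z + s • v)
    have := (hsegband s hs).1
    have h' : Kerr.rPlus M a + η ≤ Kerr.radius a (z + s • v) := this
    linarith
  · -- the field `Y` itself is timelike at the segment point (band point, `C⁰`-closeness)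
    obtain ⟨h1, h2, -⟩ := hsegband s hs
    set x : E4 := z + s • v with hx
    obtain ⟨hYxL, hKYY, -⟩ := hY x h1 h2
    have hcl := (hclose x (by
      show Kerr.rPlus M a + η / 2 ≤ Kerr.radius a x
      have h1' : Kerr.rPlus M a + η ≤ Kerr.radius a x := h1
      linarith) h2).1
    have hdiff : |G x (Y x) (Y x) - K x (Y x) (Y x)| ≤ δ * L ^ 2 := by
      have h1 : |(G x - K x) (Y x) (Y x)| ≤ ‖G x - K x‖ * ‖Y x‖ * ‖Y x‖ :=
        (Real.norm_eq_abs _ ▸ (G x - K x).le_opNorm₂ (Y x) (Y x))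
      simp only [FunLike.coe_sub, Pi.sub_apply] at h1
      refine h1.trans ?_
      have : ‖G x - K x‖ * ‖Y x‖ * ‖Y x‖ ≤ δ * L * L :=
        mul_le_mul (mul_le_mul hcl hYxL (norm_nonneg _) hδ.le) hYxL (norm_nonneg _)
          (by positivity)
      nlinarith
    have := (abs_le.1 hdiff).2
    show G x (Y x) (Y x) < 0
    linarith

end Summit.FinalStateConjecture.FinalStateConjecture.Theorems

end
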